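import Literature.NumberTheory.Automorphic.GKModulesAdCompatOfWeakDeriv
import HarnessLib

/-!
# The `K`-action of a `(𝔤, K)`-module is determined by its `𝔨`-action on `⟨exp 𝔨⟩`

Topic `NumberTheory/Automorphic`; namespace `Literature.NumberTheory.Automorphic.IsGKModule` (companion to `GKModules`,
`GKModulesOneParameter`, `GKModulesAdCompatOfWeakDeriv`, `GKModulesAdmissibleOfEigenspaces`).  Theorems only: no definition, no
named fact, no `sorry`.

Let `ρK`, `ρK'` be two `K`-actions on the same complex vector space `V` which are both compatible — in the `(𝔤, K)`-sense
`IsGKModule G ρK ρ𝔤`, `IsGKModule G ρK' ρ𝔤` (`K`-finite, weakly continuous, weak derivative `d/dt|₀ ℓ (ρK (exp tY) v) = ℓ (ρ𝔤 Y v)`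
along `𝔨`) — with the SAME real Lie algebra action `ρ𝔤`.  Then `ρK` and `ρK'` agree on the subgroup of `K` generated by `exp 𝔨`,
hence coincide when `K = ⟨exp 𝔨⟩` (e.g. `K` connected compact; `K = U(p) × U(q) ⊂ U(p,q)` where even `K = exp 𝔨`,
`BorelWallach2000/UpqMaximalCompactExp`).  In other words: for connected `K` a `(𝔤, K)`-module is a `𝔤`-module whose `𝔨`-action
integrates, and the integration is UNIQUE (Knapp–Vogan §I.4 (1.64)–(1.65); Borel–Wallach 0 §2.5; Wallach §3.3.1).  This is the
converse companion of `IsGKModule.of_hasWeakDeriv` (`Ad`-compatibility is automatic) and it lets every statement proved for ONE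
compatible `K`-action (e.g. an explicit one, such as Kovačević's `K`-type action on the ladder module of `SU(2,1)`) be read for ANY.

* §1 `hasDerivAt_crossCoeff_zero` — for `Y ∈ 𝔨`, `v ∈ V`, `ℓ ∈ V^*`, the CROSS COEFFICIENT `s ↦ ℓ (ρK' (exp sY)⁻¹ (ρK (exp sY) v))`
  has derivative `0` at `s = 0`: in coordinates of the finite-dimensional `K`-span `U` of `v` under `ρK` (which is `𝔨`-stable) it is the
  finite sum `Σ_i e_i(ρK (exp sY) v) · ℓ (ρK' (exp sY)⁻¹ b_i)`, and the product rule gives `ℓ (ρ𝔤 Y v) − ℓ (ρ𝔤 Y v) = 0`.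
* §2 `crossCoeff_eq` — by the one-parameter group law the derivative vanishes at every `t`, so the cross coefficient is constant
  `= ℓ v`; hence **`apply_expK_eq`**: `ρK (exp Y) v = ρK' (exp Y) v` (functionals separate points).
* §3 **`eq_of_mem_closure_expK`** (`ρK k = ρK' k` for `k ∈ ⟨exp 𝔨⟩`), **`eq_of_closure_expK_eq_top`** and
  **`eq_of_expK_surjective`** (`ρK = ρK'`).

## Mathlib / Literature search

Tree: `IsGKModule` (`GKModules`), `RealMatrixGroup.expK_add_smul`∕`expK_zero_smul` (`GKModulesOneParameter`),
`IsGKModule.expK_neg_smul`, `apply_mem_of_K_stable_of_hasWeakDeriv`, `mem_span_orbit_self` (`GKModulesAdCompatOfWeakDeriv`),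
`GKTensor.kOrbitSpan_stable` (`GKModuleTensor`).  Mathlib: `Subspace.dualLift`, `Module.forall_dual_apply_eq_zero_iff`,
`HasDerivAt.fun_sum`∕`fun_mul`, `is_const_of_deriv_eq_zero`, `Subgroup.closure_induction`.
Dedup: `rg "ρK = ρK'|eq_of_expK_surjective|crossCoeff"` over `Literature/` — no hits (the tree has the `Ad`-compatibility companion
`of_hasWeakDeriv_of_expK_surjective` only).

## References

* A. W. Knapp, D. A. Vogan, *Cohomological Induction and Unitary Representations*, Princeton (1995), §I.4 (1.64)–(1.65). [KnappVogan1995]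
* A. Borel, N. Wallach, *Continuous cohomology, discrete subgroups, and representations of reductive groups*, 2nd ed., AMS (2000), 0 §2.5.
  [BorelWallach2000]
* N. R. Wallach, *Real Reductive Groups I*, Academic Press (1988), §3.3.1. [WallachRRG1]
-/

-- Mathlib idiom (commutator bracket on `Module.End`, `Mathlib/Algebra/Lie/OfAssociative.lean`), as in `GKModules` and its companions
-- (needed to state `ρ𝔤 : 𝔤 →ₗ⁅ℝ⁆ End V`)
attribute [local instance 100] LieRing.ofAssociativeRing

open scoped MatrixGroups Matrix
open Module

noncomputable section

namespace Literature.NumberTheory.Automorphic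

variable {A : Type*} [NormedCommRing A] [NormedAlgebra ℝ A] [NormedAlgebra ℚ A] [CompleteSpace A]
  [StarRing A] [StarModule ℝ A] [ContinuousStar A] {N : Type*} [Fintype N] [DecidableEq N]
  {G : RealMatrixGroup A N}
  {V : Type*} [AddCommGroup V] [Module ℂ V]
  {ρK ρK' : Representation ℂ G.maximalCompact V} {ρ𝔤 : G.lie →ₗ⁅ℝ⁆ Module.End ℂ V}

namespace IsGKModule

/-! ## §1 The cross coefficient has zero derivative -/

/-- **Core computation.**  For two `K`-actions `ρK`, `ρK'` compatible with the same `ρ𝔤`, `Y ∈ 𝔨`, `v ∈ V` and a functional `ℓ`, the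
cross coefficient `s ↦ ℓ (ρK' (exp sY)⁻¹ (ρK (exp sY) v))` has derivative `0` at `s = 0` (product rule in coordinates of the
finite-dimensional, `K`- hence `𝔨`-stable `K`-span of `v`; the two weak derivatives `± ℓ (ρ𝔤 Y v)` cancel).
[cite: KnappVogan1995, §I.4 (1.64)–(1.65)] [cite: BorelWallach2000, 0 §2.5] -/
theorem hasDerivAt_crossCoeff_zero (h : IsGKModule G ρK ρ𝔤) (h' : IsGKModule G ρK' ρ𝔤)
    (Y : G.compactLie) (v : V) (ℓ : Module.Dual ℂ V) :
    HasDerivAt (fun s : ℝ ↦ ℓ (ρK' (G.expK (s • Y))⁻¹ (ρK (G.expK (s • Y)) v))) 0 0 := by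
  set U : Submodule ℂ V := Submodule.span ℂ (Set.range fun k : G.maximalCompact ↦ ρK k v) with hUdef
  haveI : FiniteDimensional ℂ U := h.kFinite v
  set Yg : G.lie := LieSubalgebra.inclusion G.compactLie_le_lie Y with hYg
  set b := Module.finBasis ℂ U with hb
  set e : Fin (Module.finrank ℂ U) → Module.Dual ℂ V := fun i ↦ Subspace.dualLift U (b.coord i) with he
  have he_apply : ∀ (i) (u : V) (hu : u ∈ U), e i u = b.repr ⟨u, hu⟩ i := fun i u hu ↦ by
    rw [he]; exact Subspace.dualLift_of_mem hu
  -- reconstruction of `μ (T u)`, `u ∈ U`, from the coordinates of `u`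
  have hrecUℓ : ∀ (T : V →ₗ[ℂ] V) (μ : Module.Dual ℂ V) (u : V), u ∈ U →
      μ (T u) = ∑ i, e i u * μ (T (b i : V)) := by
    intro T μ u hu
    have hsum := b.sum_repr ⟨u, hu⟩
    have h' : u = ∑ i, b.repr ⟨u, hu⟩ i • (b i : V) := by
      conv_lhs => rw [show u = ((⟨u, hu⟩ : U) : V) from rfl, ← hsum]
      simp only [Submodule.coe_sum, Submodule.coe_smul]
    conv_lhs => rw [h']
    simp only [map_sum, map_smul, smul_eq_mul]
    exact Finset.sum_congr rfl fun i _ ↦ by rw [he_apply i u hu]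
  -- the two one-parameter derivatives
  have ha : ∀ i, HasDerivAt (fun s : ℝ ↦ e i (ρK (G.expK (s • Y)) v)) (e i (ρ𝔤 Yg v)) 0 :=
    fun i ↦ h.hasWeakDeriv Y v (e i)
  have hd : ∀ w : V, HasDerivAt (fun s : ℝ ↦ ℓ (ρK' (G.expK (s • Y))⁻¹ w)) (-ℓ (ρ𝔤 Yg w)) 0 := by
    intro w
    have h1 := h'.hasWeakDeriv (-Y) w ℓ
    have h2 : (fun t : ℝ ↦ ℓ (ρK' (G.expK (t • -Y)) w)) = fun s : ℝ ↦ ℓ (ρK' (G.expK (s • Y))⁻¹ w) := by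
      funext s
      rw [smul_neg, ← neg_smul, expK_neg_smul]
    have h3 : ℓ (ρ𝔤 (LieSubalgebra.inclusion G.compactLie_le_lie (-Y)) w) = -ℓ (ρ𝔤 Yg w) := by
      rw [map_neg, map_neg, LinearMap.neg_apply, map_neg]
    rw [h2, h3] at h1
    exact h1
  -- the cross coefficient in coordinates
  have hfun : (fun s : ℝ ↦ ℓ (ρK' (G.expK (s • Y))⁻¹ (ρK (G.expK (s • Y)) v))) =
      fun s : ℝ ↦ ∑ i, e i (ρK (G.expK (s • Y)) v) * ℓ (ρK' (G.expK (s • Y))⁻¹ (b i : V)) := by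
    funext s
    have hu : ρK (G.expK (s • Y)) v ∈ U := GKTensor.kOrbitSpan_stable G ρK v _ (mem_span_orbit_self v)
    exact hrecUℓ (ρK' (G.expK (s • Y))⁻¹) ℓ _ hu
  rw [hfun]
  have hsum := HasDerivAt.fun_sum (u := Finset.univ) fun i _ ↦ (ha i).fun_mul (hd (b i : V))
  have h0K : G.expK ((0 : ℝ) • Y) = 1 := RealMatrixGroup.expK_zero_smul Y
  simp only [h0K, inv_one, map_one, Module.End.one_apply] at hsum
  -- the value of the derivative: `ℓ (ρ𝔤 Y v) - ℓ (ρ𝔤 Y v)`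
  have hv : v ∈ U := mem_span_orbit_self v
  have hYv : ρ𝔤 Yg v ∈ U :=
    apply_mem_of_K_stable_of_hasWeakDeriv h.hasWeakDeriv Y (fun k u hu ↦ GKTensor.kOrbitSpan_stable G ρK v k hu) hv
  have h1 : ∑ i, e i (ρ𝔤 Yg v) * ℓ (b i : V) = ℓ (ρ𝔤 Yg v) := by
    have h := hrecUℓ LinearMap.id ℓ (ρ𝔤 Yg v) hYv
    simp only [LinearMap.id_apply] at h
    exact h.symm
  have h2 : ∑ i, e i v * -ℓ (ρ𝔤 Yg (b i : V)) = -ℓ (ρ𝔤 Yg v) := by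
    rw [hrecUℓ (ρ𝔤 Yg) ℓ v hv, ← Finset.sum_neg_distrib]
    exact Finset.sum_congr rfl fun i _ ↦ by rw [mul_neg]
  refine hsum.congr_deriv ?_
  simp only [Finset.sum_add_distrib, h1, h2]
  ring

/-! ## §2 The cross coefficient is constant; the two actions agree on `exp 𝔨` -/

/-- **The cross coefficient is constant**: `ℓ (ρK' (exp tY)⁻¹ (ρK (exp tY) v)) = ℓ v` for all `t` — its derivative at `t` is the
derivative at `0` for the data `(ρK (exp tY) v, ℓ ∘ ρK' (exp tY)⁻¹)` (one-parameter group law), which vanishes (§1).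
[cite: KnappVogan1995, §I.4 (1.64)–(1.65)] [cite: BorelWallach2000, 0 §2.5] -/
theorem crossCoeff_eq (h : IsGKModule G ρK ρ𝔤) (h' : IsGKModule G ρK' ρ𝔤)
    (Y : G.compactLie) (v : V) (ℓ : Module.Dual ℂ V) (t : ℝ) :
    ℓ (ρK' (G.expK (t • Y))⁻¹ (ρK (G.expK (t • Y)) v)) = ℓ v := by
  set g : ℝ → ℂ := fun t ↦ ℓ (ρK' (G.expK (t • Y))⁻¹ (ρK (G.expK (t • Y)) v)) with hg
  have hderiv : ∀ t : ℝ, HasDerivAt g 0 t := by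
    intro t
    set kt := G.expK (t • Y) with hkt
    have h0 := hasDerivAt_crossCoeff_zero h h' Y (ρK kt v) (ℓ ∘ₗ ρK' kt⁻¹)
    have h1 : (fun s : ℝ ↦ (ℓ ∘ₗ ρK' kt⁻¹) (ρK' (G.expK (s • Y))⁻¹ (ρK (G.expK (s • Y)) (ρK kt v)))) =
        fun s : ℝ ↦ g (t + s) := by
      funext s
      simp only [hg, LinearMap.coe_comp, Function.comp_apply]
      rw [add_comm, RealMatrixGroup.expK_add_smul, mul_inv_rev, map_mul, map_mul, Module.End.mul_apply,
        Module.End.mul_apply]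
    rw [h1] at h0
    have h2 := HasDerivAt.comp_sub_const (f := fun s : ℝ ↦ g (t + s)) t t (by rwa [sub_self])
    refine h2.congr_of_eventuallyEq (Filter.Eventually.of_forall fun u ↦ ?_)
    simp only [add_sub_cancel]
  have hconst := is_const_of_deriv_eq_zero (fun t ↦ (hderiv t).differentiableAt) (fun t ↦ (hderiv t).deriv) t 0
  have hg0 : g 0 = ℓ v := by
    simp only [hg, RealMatrixGroup.expK_zero_smul, inv_one, map_one, Module.End.one_apply]
  rw [← hg0, ← hconst]

/-- **Two compatible `K`-actions agree on `exp 𝔨`**: `ρK (exp Y) = ρK' (exp Y)` for every `Y ∈ 𝔨`.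
[cite: KnappVogan1995, §I.4 (1.64)–(1.65)] [cite: BorelWallach2000, 0 §2.5] -/
theorem apply_expK_eq (h : IsGKModule G ρK ρ𝔤) (h' : IsGKModule G ρK' ρ𝔤) (Y : G.compactLie) :
    ρK (G.expK Y) = ρK' (G.expK Y) := by
  have h1 : G.expK Y = G.expK ((1 : ℝ) • Y) := by rw [one_smul]
  refine LinearMap.ext fun v ↦ ?_
  -- `ρK' (exp Y)⁻¹ (ρK (exp Y) v) = v`
  have h2 : ρK' (G.expK Y)⁻¹ (ρK (G.expK Y) v) = v := by
    rw [← sub_eq_zero, ← forall_dual_apply_eq_zero_iff ℂ]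
    intro ℓ
    rw [map_sub, sub_eq_zero, h1]
    exact crossCoeff_eq h h' Y v ℓ 1
  have h3 := congrArg (ρK' (G.expK Y)) h2
  rwa [← Module.End.mul_apply, ← map_mul, mul_inv_cancel, map_one, Module.End.one_apply] at h3

/-! ## §3 Uniqueness of the compatible `K`-action on `⟨exp 𝔨⟩` -/

/-- **Two compatible `K`-actions agree on the subgroup generated by `exp 𝔨`.** [cite: BorelWallach2000, 0 §2.5] -/
theorem eq_of_mem_closure_expK (h : IsGKModule G ρK ρ𝔤) (h' : IsGKModule G ρK' ρ𝔤)
    {k : G.maximalCompact} (hk : k ∈ Subgroup.closure (Set.range G.expK)) : ρK k = ρK' k := by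
  induction hk using Subgroup.closure_induction with
  | mem k hk =>
    obtain ⟨Y, rfl⟩ := hk
    exact apply_expK_eq h h' Y
  | one => rw [map_one, map_one]
  | mul k k' _ _ ih ih' => rw [map_mul, map_mul, ih, ih']
  | inv k _ ih =>
    have h1 : ρK k⁻¹ * ρK k = 1 := by rw [← map_mul, inv_mul_cancel, map_one]
    have h2 : ρK' k * ρK' k⁻¹ = 1 := by rw [← map_mul, mul_inv_cancel, map_one]
    calc ρK k⁻¹ = ρK k⁻¹ * (ρK' k * ρK' k⁻¹) := by rw [h2, mul_one]
      _ = (ρK k⁻¹ * ρK k) * ρK' k⁻¹ := by rw [ih, mul_assoc]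
      _ = ρK' k⁻¹ := by rw [h1, one_mul]

/-- **UNIQUENESS OF THE `K`-ACTION when `K = ⟨exp 𝔨⟩`**: two `K`-actions making `(ρK, ρ𝔤)` and `(ρK', ρ𝔤)` `(𝔤, K)`-modules for
the same `ρ𝔤` coincide — for connected `K` a `(𝔤, K)`-module structure extending a given `𝔤`-action is unique.
[cite: KnappVogan1995, §I.4 (1.64)–(1.65)] [cite: BorelWallach2000, 0 §2.5] -/
theorem eq_of_closure_expK_eq_top (h : IsGKModule G ρK ρ𝔤) (h' : IsGKModule G ρK' ρ𝔤)
    (hK : Subgroup.closure (Set.range G.expK) = ⊤) : ρK = ρK' := by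
  refine MonoidHom.ext fun k ↦ ?_
  exact eq_of_mem_closure_expK h h' (hK ▸ Subgroup.mem_top k)

/-- **Uniqueness of the `K`-action, surjective-exponential form** (`K = exp 𝔨`, e.g. `U(p) × U(q) ⊂ U(p,q)`).
[cite: KnappVogan1995, §I.4 (1.64)–(1.65)] [cite: BorelWallach2000, 0 §2.5] -/
theorem eq_of_expK_surjective (h : IsGKModule G ρK ρ𝔤) (h' : IsGKModule G ρK' ρ𝔤)
    (hK : ∀ k : G.maximalCompact, ∃ Y : G.compactLie, G.expK Y = k) : ρK = ρK' := by
  refine MonoidHom.ext fun k ↦ ?_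
  obtain ⟨Y, rfl⟩ := hK k
  exact apply_expK_eq h h' Y

/-- **Transfer of `(𝔤, K)`-properties between compatible `K`-actions** (`K = ⟨exp 𝔨⟩`): irreducibility, admissibility and
`(𝔤, K)`-equivalence class of `(ρK, ρ𝔤)` are those of `(ρK', ρ𝔤)` (the actions are equal). [cite: BorelWallach2000, 0 §2.5] -/
theorem isIrreducibleGK_iff_of_closure_expK_eq_top (h : IsGKModule G ρK ρ𝔤) (h' : IsGKModule G ρK' ρ𝔤)
    (hK : Subgroup.closure (Set.range G.expK) = ⊤) :
    (IsIrreducibleGK ρK ρ𝔤 ↔ IsIrreducibleGK ρK' ρ𝔤) ∧ (IsAdmissibleGK ρK ↔ IsAdmissibleGK ρK') := by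
  obtain rfl := eq_of_closure_expK_eq_top h h' hK
  exact ⟨Iff.rfl, Iff.rfl⟩

end IsGKModule

/-! ## §4 (EDITION 2) A `𝔤`-isomorphism between `(𝔤, K)`-modules is `K`-equivariant when `K = exp 𝔨`

Appended 2026-08-31 (A-p10 g17) for the integrator's O1 seam (`Theorems/F0P3ArchTokenSeam`, F0P3-p01): transport the `K`-action of the target
through a complex-linear isomorphism `T` intertwining the `𝔤`-actions; the transported action is again compatible with `ρ𝔤`, hence equals `ρK`
by §3 — so `T` intertwines the `K`-actions too and is a `(𝔤, K)`-equivalence. -/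

namespace IsGKModule

variable {V' : Type*} [AddCommGroup V'] [Module ℂ V']
  {σK : Representation ℂ G.maximalCompact V'} {σ𝔤 : G.lie →ₗ⁅ℝ⁆ Module.End ℂ V'}

/-- **The transported `K`-action** `k ↦ T⁻¹ ∘ σK k ∘ T` along a linear isomorphism `T : V ≃ V′` intertwining `ρ𝔤` and `σ𝔤` is compatible
with `ρ𝔤` (all four `(𝔤, K)`-axioms transport through `T`). [cite: KnappVogan1995, §I.4 (1.64)–(1.65)] [cite: BorelWallach2000, 0 §2.5] -/
theorem conj_linearEquiv (h' : IsGKModule G σK σ𝔤) (T : V ≃ₗ[ℂ] V') (hT : ∀ (X : G.lie) (v : V), T (ρ𝔤 X v) = σ𝔤 X (T v)) :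
    IsGKModule G (((T.symm.conjAlgEquiv ℂ).toAlgHom.toMonoidHom).comp σK) ρ𝔤 := by
  -- the transported action, pointwise
  have happ : ∀ (k : G.maximalCompact) (v : V),
      (((T.symm.conjAlgEquiv ℂ).toAlgHom.toMonoidHom).comp σK) k v = T.symm (σK k (T v)) := fun k v ↦ by
    simp [LinearEquiv.conjAlgEquiv_apply]
  -- `T⁻¹ (σ𝔤 X w) = ρ𝔤 X (T⁻¹ w)`
  have hT' : ∀ (X : G.lie) (w : V'), T.symm (σ𝔤 X w) = ρ𝔤 X (T.symm w) := fun X w ↦ by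
    rw [← T.symm_apply_apply (ρ𝔤 X (T.symm w)), hT, T.apply_symm_apply]
  refine ⟨fun v ↦ ?_, fun v ℓ ↦ ?_, fun k X ↦ ?_, fun X v ℓ ↦ ?_⟩
  · -- `K`-finite: the orbit span is the image under `T⁻¹` of the orbit span of `T v`
    have hF := h'.kFinite (T v)
    have hle : Submodule.span ℂ (Set.range fun k : G.maximalCompact ↦
        (((T.symm.conjAlgEquiv ℂ).toAlgHom.toMonoidHom).comp σK) k v) ≤
        (Submodule.span ℂ (Set.range fun k : G.maximalCompact ↦ σK k (T v))).map T.symm.toLinearMap := by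
      rw [Submodule.span_le]
      rintro _ ⟨k, rfl⟩
      dsimp only
      rw [happ]
      exact Submodule.mem_map_of_mem (Submodule.subset_span ⟨k, rfl⟩)
    exact Submodule.finiteDimensional_of_le hle
  · -- weak continuity through the functional `ℓ ∘ T⁻¹`
    have hc := h'.weaklyContinuous (T v) (ℓ ∘ₗ T.symm.toLinearMap)
    refine hc.congr fun k ↦ ?_
    rw [happ, LinearMap.comp_apply, LinearEquiv.coe_coe]
  · -- `Ad`-compatibility through `T`
    refine LinearMap.ext fun v ↦ ?_
    have hk := LinearMap.congr_fun (h'.ad_compat k X) (T v)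
    simp only [LinearMap.coe_comp, Function.comp_apply] at hk ⊢
    rw [happ, happ, hT, T.apply_symm_apply, hk, hT']
    rw [T.symm_apply_apply]
  · -- weak derivative through the functional `ℓ ∘ T⁻¹`
    have hd := h'.hasWeakDeriv X (T v) (ℓ ∘ₗ T.symm.toLinearMap)
    have h1 : (fun t : ℝ ↦ (ℓ ∘ₗ T.symm.toLinearMap) (σK (G.expK (t • X)) (T v))) =
        fun t : ℝ ↦ ℓ ((((T.symm.conjAlgEquiv ℂ).toAlgHom.toMonoidHom).comp σK) (G.expK (t • X)) v) := by
      funext t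
      rw [happ, LinearMap.comp_apply, LinearEquiv.coe_coe]
    have h2 : (ℓ ∘ₗ T.symm.toLinearMap) (σ𝔤 (LieSubalgebra.inclusion G.compactLie_le_lie X) (T v)) =
        ℓ (ρ𝔤 (LieSubalgebra.inclusion G.compactLie_le_lie X) v) := by
      rw [LinearMap.comp_apply, LinearEquiv.coe_coe, hT', T.symm_apply_apply]
    rw [h1, h2] at hd
    exact hd

/-- **A `𝔤`-isomorphism between `(𝔤, K)`-modules is `K`-equivariant when every `k ∈ K` is an exponential** (`K = exp 𝔨`, e.g.
`U(p) × U(q) ⊂ U(p,q)` via `BorelWallach2000/UpqMaximalCompactExp.upq_exists_expK_eq`): the transported `K`-action (`conj_linearEquiv`) is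
compatible with `ρ𝔤`, hence equals `ρK` (`eq_of_expK_surjective`). [cite: KnappVogan1995, §I.4 (1.64)–(1.65)] [cite: BorelWallach2000, 0 §2.5] -/
theorem map_ρK_of_lieEquiv (h : IsGKModule G ρK ρ𝔤) (h' : IsGKModule G σK σ𝔤) (T : V ≃ₗ[ℂ] V')
    (hT : ∀ (X : G.lie) (v : V), T (ρ𝔤 X v) = σ𝔤 X (T v))
    (hK : ∀ k : G.maximalCompact, ∃ Y : G.compactLie, G.expK Y = k) (k : G.maximalCompact) (v : V) :
    T (ρK k v) = σK k (T v) := by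
  have heq := eq_of_expK_surjective h (h'.conj_linearEquiv T hT) hK
  have happ : (((T.symm.conjAlgEquiv ℂ).toAlgHom.toMonoidHom).comp σK) k v = T.symm (σK k (T v)) := by
    simp [LinearEquiv.conjAlgEquiv_apply]
  rw [heq, happ, T.apply_symm_apply]

/-- The same on the subgroup generated by `exp 𝔨` (`K = ⟨exp 𝔨⟩`, e.g. `K` connected compact).
[cite: KnappVogan1995, §I.4 (1.64)–(1.65)] [cite: BorelWallach2000, 0 §2.5] -/
theorem map_ρK_of_lieEquiv_of_closure_expK_eq_top (h : IsGKModule G ρK ρ𝔤) (h' : IsGKModule G σK σ𝔤) (T : V ≃ₗ[ℂ] V')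
    (hT : ∀ (X : G.lie) (v : V), T (ρ𝔤 X v) = σ𝔤 X (T v))
    (hK : Subgroup.closure (Set.range G.expK) = ⊤) (k : G.maximalCompact) (v : V) :
    T (ρK k v) = σK k (T v) := by
  have heq := eq_of_closure_expK_eq_top h (h'.conj_linearEquiv T hT) hK
  have happ : (((T.symm.conjAlgEquiv ℂ).toAlgHom.toMonoidHom).comp σK) k v = T.symm (σK k (T v)) := by
    simp [LinearEquiv.conjAlgEquiv_apply]
  rw [heq, happ, T.apply_symm_apply]

/-- **`𝔤`-isomorphic `(𝔤, K)`-modules are `(𝔤, K)`-equivalent when `K = exp 𝔨`** (`AreGKEquivalent`).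
[cite: KnappVogan1995, §I.4 (1.64)–(1.65)] [cite: BorelWallach2000, 0 §2.5] -/
theorem areGKEquivalent_of_lieEquiv (h : IsGKModule G ρK ρ𝔤) (h' : IsGKModule G σK σ𝔤) (T : V ≃ₗ[ℂ] V')
    (hT : ∀ (X : G.lie) (v : V), T (ρ𝔤 X v) = σ𝔤 X (T v))
    (hK : ∀ k : G.maximalCompact, ∃ Y : G.compactLie, G.expK Y = k) : AreGKEquivalent ρK ρ𝔤 σK σ𝔤 :=
  ⟨{ toLinearEquiv := T
     map_ρK := fun k v ↦ map_ρK_of_lieEquiv h h' T hT hK k v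
     map_ρ𝔤 := hT }⟩

/-- The same on `K = ⟨exp 𝔨⟩`. [cite: KnappVogan1995, §I.4 (1.64)–(1.65)] [cite: BorelWallach2000, 0 §2.5] -/
theorem areGKEquivalent_of_lieEquiv_of_closure_expK_eq_top (h : IsGKModule G ρK ρ𝔤) (h' : IsGKModule G σK σ𝔤)
    (T : V ≃ₗ[ℂ] V') (hT : ∀ (X : G.lie) (v : V), T (ρ𝔤 X v) = σ𝔤 X (T v))
    (hK : Subgroup.closure (Set.range G.expK) = ⊤) : AreGKEquivalent ρK ρ𝔤 σK σ𝔤 :=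
  ⟨{ toLinearEquiv := T
     map_ρK := fun k v ↦ map_ρK_of_lieEquiv_of_closure_expK_eq_top h h' T hT hK k v
     map_ρ𝔤 := hT }⟩

end IsGKModule

end Literature.NumberTheory.Automorphic
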